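import Literature.Topology.FourManifolds.DiscTheoremDiffeotopy
import Literature.Topology.FourManifolds.ClosedBallSmoothEmbeddings
import Literature.Topology.FourManifolds.ClosedBallProofs
import Literature.Topology.FourManifolds.FieldPushforward
import HarnessLib

/-!
# Small smoothly embedded closed balls around a point (base case of the ball-neighbourhood
# theorem for smoothly collapsible sets)

Topic `Literature/Topology/FourManifolds`; fact seat
`provefact-Literature.Topology.FourManifolds.exists-2dbcd4ab93` (the named fact
`Literature.Topology.FourManifolds.exists_isSmoothEmbedding_closedBall_of_isSmoothlyCollapsible`,
`Collapsible.lean`: a smoothly collapsible subset of a smooth manifold has arbitrarily small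
neighbourhoods which are smoothly embedded closed balls; Hirsch 1962).  The proof in the tree is
by induction on the collapse; this file is the **base case** — a point:

* `exists_isSmoothEmbedding_closedBall_of_mem_nhds` — every neighbourhood `U` of a point `p` of a
  smooth manifold `M` (Hausdorff, modelled on `ℝⁿ⁺¹`, no boundary) contains a smoothly embedded
  closed ball `j : 𝔻ⁿ⁺¹ → M` (Mathlib's `Manifold.IsSmoothEmbedding (𝓡∂ (n + 1)) (𝓡 (n + 1)) ∞`,
  the closed unit ball with its manifold-with-boundary structure of `ClosedBall.lean`) with `p`
  in the image of the open ball: restrict the inverse of a chart of the maximal atlas centred at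
  `p` with target all of `ℝⁿ⁺¹` and source inside `U`
  (`exists_mem_maximalAtlas_target_eq_univ_source_subset_apply_eq_zero`) to `𝔻ⁿ⁺¹`
  (`isSmoothEmbedding_comp_coe_closedBall_of_injective_mfderiv`).
* `exists_isSmoothEmbedding_closedBall_diffeomorph_image` — transport of such balls by a
  diffeomorphism `G` of `M`: `G ∘ j` is again a smoothly embedded closed ball
  (`Manifold.IsSmoothEmbedding.diffeomorph_comp`), with image `G '' (range j)`.

Everything here is proved; no definitions, no named facts.

## References

* M. W. Hirsch, *Smooth regular neighborhoods*, Ann. of Math. (2) 76 (1962) 524–530. [Hirsch1962]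
* M. W. Hirsch, *Differential Topology*, GTM 33 (1976), Ch. 1 §3, Thm. 3.1. [HirschDT1976]
-/

open scoped Manifold ContDiff Topology
open Set Function Metric

noncomputable section

namespace Literature.Topology.FourManifolds

universe u

variable {n : ℕ} {M : Type u} [TopologicalSpace M] [ChartedSpace (EuclideanSpace ℝ (Fin (n + 1))) M]
  [IsManifold (𝓡 (n + 1)) ∞ M]

omit [IsManifold (𝓡 (n + 1)) ∞ M] in
/-- The inverse of a chart of the maximal atlas with target the whole model space is smooth and
has injective differential everywhere. [folklore] -/
theorem contMDiff_symm_and_injective_mfderiv_of_target_eq_univ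
    {e : OpenPartialHomeomorph M (EuclideanSpace ℝ (Fin (n + 1)))} (he : e ∈ IsManifold.maximalAtlas (𝓡 (n + 1)) ∞ M)
    (htgt : e.target = univ) :
    ContMDiff (𝓡 (n + 1)) (𝓡 (n + 1)) ∞ e.symm ∧
      ∀ y, Injective (mfderiv (𝓡 (n + 1)) (𝓡 (n + 1)) e.symm y) := by
  have hsymm : ContMDiff (𝓡 (n + 1)) (𝓡 (n + 1)) ∞ e.symm := by
    have h := contMDiffOn_symm_of_mem_maximalAtlas he
    rw [htgt] at h
    exact contMDiffOn_univ.1 h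
  refine ⟨hsymm, fun y => ?_⟩
  have hn : (∞ : ℕ∞ω) ≠ 0 := by simp
  have hy : y ∈ e.target := by rw [htgt]; exact mem_univ y
  have hx : e.symm y ∈ e.source := e.map_target hy
  have hΦ : MDifferentiableAt (𝓡 (n + 1)) (𝓡 (n + 1)) e.symm y := hsymm.mdifferentiableAt hn
  have hΨ : MDifferentiableAt (𝓡 (n + 1)) (𝓡 (n + 1)) e (e.symm y) :=
    ((contMDiffOn_of_mem_maximalAtlas he).contMDiffAt (e.open_source.mem_nhds hx)).mdifferentiableAt
      hn
  have h₁ : e ∘ e.symm =ᶠ[𝓝 y] id :=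
    Filter.Eventually.of_forall fun z => e.right_inv (by rw [htgt]; exact mem_univ z)
  have h₂ : e.symm ∘ e =ᶠ[𝓝 (e.symm y)] id := e.eventually_left_inverse hx
  have hinv := (isInvertible_mfderiv_of_eventuallyEq hΦ hΨ h₁ h₂).1
  exact hinv.injective

variable [T2Space M]

/-- **Points have arbitrarily small smoothly embedded closed-ball neighbourhoods.**  For every
neighbourhood `U` of a point `p` of a smooth manifold `M` modelled on `ℝⁿ⁺¹` (Hausdorff, no
boundary) there is a smooth embedding `j : 𝔻ⁿ⁺¹ → M` of the closed unit ball (a manifold with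
boundary, model `𝓡∂ (n + 1)`) with `j(𝔻ⁿ⁺¹) ⊆ U` and `p` in the image of the open unit ball:
`j = e⁻¹|𝔻ⁿ⁺¹` for a chart `e` of the maximal atlas centred at `p`, onto `ℝⁿ⁺¹`, with source in
`U`.  (Base case — a vertex — of the ball-neighbourhood theorem for collapsible sets.)
[cite: HirschDT1976, Ch. 1 §3 Thm. 3.1] -/
theorem exists_isSmoothEmbedding_closedBall_of_mem_nhds {p : M} {U : Set M} (hU : U ∈ 𝓝 p) :
    ∃ j : (Metric.closedBall (0 : EuclideanSpace ℝ (Fin (n + 1))) 1) → M, Manifold.IsSmoothEmbedding (𝓡∂ (n + 1)) (𝓡 (n + 1)) ∞ j ∧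
      range j ⊆ U ∧ p ∈ j '' {x | ‖(x : EuclideanSpace ℝ (Fin (n + 1)))‖ < 1} := by
  obtain ⟨e, he, hpe, hsrc, htgt, hep⟩ :=
    exists_mem_maximalAtlas_target_eq_univ_source_subset_apply_eq_zero (n := n + 1) p hU
  obtain ⟨hsymm, hinj⟩ := contMDiff_symm_and_injective_mfderiv_of_target_eq_univ he htgt
  have htgt' : ∀ y, y ∈ e.target := fun y => by rw [htgt]; exact mem_univ y
  refine ⟨e.symm ∘ Subtype.val, ?_, ?_, ?_⟩
  · exact isSmoothEmbedding_comp_coe_closedBall_of_injective_mfderiv hsymm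
      (fun a _ b _ hab => e.symm.injOn (htgt' a) (htgt' b) hab) fun y _ => hinj y
  · rintro _ ⟨x, rfl⟩
    exact hsrc (e.map_target (htgt' _))
  · refine ⟨⟨0, by simp⟩, by simp, ?_⟩
    change e.symm 0 = p
    rw [← hep, e.left_inv hpe]

omit [T2Space M] in
/-- **Diffeomorphisms transport smoothly embedded balls**: if `j : 𝔻ⁿ⁺¹ → M` is a smooth
embedding and `G` a diffeomorphism of `M`, then `G ∘ j` is a smooth embedding
(`Manifold.IsSmoothEmbedding.diffeomorph_comp`) with `range (G ∘ j) = G '' range j` and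
`(G ∘ j) '' A = G '' (j '' A)`. [folklore] -/
theorem isSmoothEmbedding_diffeomorph_comp_closedBall {j : (Metric.closedBall (0 : EuclideanSpace ℝ (Fin (n + 1))) 1) → M}
    (hj : Manifold.IsSmoothEmbedding (𝓡∂ (n + 1)) (𝓡 (n + 1)) ∞ j)
    (G : M ≃ₘ^∞⟮𝓡 (n + 1), 𝓡 (n + 1)⟯ M) :
    Manifold.IsSmoothEmbedding (𝓡∂ (n + 1)) (𝓡 (n + 1)) ∞ (G ∘ j) ∧
      range (G ∘ j) = G '' range j ∧ ∀ A, (G ∘ j) '' A = G '' (j '' A) :=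
  ⟨hj.diffeomorph_comp G, range_comp G j, fun A => image_comp G j A⟩

end Literature.Topology.FourManifolds
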